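import Summits.AnomalousDissipation.AnomalousDissipation.Theorems.SolenoidalFractalHomogenisationLagrangianStepVmodFrameDefsJ
import HarnessLib

/-!
# K1L_D (stmt-AnomalousDissipation-27980), (ℓ3-A) road A, (S1) input: the TIME DERIVATIVE of a pointwise inverse frame — `G′J + GJ′ = 0`, hence
# `J′ = −J G′ J` and `|J′| ≤ 9·C_J²·|G′|` (helper; `--supports 27980 --as helper`; prover ad-k1loc-p3 g11; RULING D28-18 (5): the `J′•ζ₀` term of the
# (S1) N-bound needs an EXPLICIT bound of `J′` from `IsFrameRegular.aeDeriv/aeDerivG` and `|G′| ≤ θ/Tw` (`IsFrameModulation.rate`).)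

Matrix products are differentiated ENTRYWISE (`hasDerivAt_pi`, `HasDerivAt.sum/mul`; `Matrix (Fin 3) (Fin 3) ℝ` carries the product topology but no
normed-ring instance).
* `hasDerivAt_entry` — entries of a matrix-valued derivative; `deriv_mul_entry_eq_zero` — if `G s * J s = 1` for all `s` then
  `Σ_b (G′ a b · J b c + G a b · J′ b c) = 0`; `inverse_deriv_eq` — `J′ = −(J * G′ * J)`; **`abs_inverse_deriv_entry_le`** — `|J′ a c| ≤ 9·C_J·B′·C_J`
  for `|J| ≤ C_J`, `|G′| ≤ B′`.
`sorry`-free; NOT a proof of any block, of K1L_D or of AD; rung F-D1.A0.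
-/

set_option linter.dupNamespace false

noncomputable section

namespace Summit.AnomalousDissipation.AnomalousDissipation.Theorems.SolenoidalFractalHomogenisation.LagrangianStep.VmodDist

open Set

/-- Entries of a matrix-valued derivative. -/
theorem hasDerivAt_entry {F F' : ℝ → Matrix (Fin 3) (Fin 3) ℝ} {t : ℝ} (h : HasDerivAt F (F' t) t) (a c : Fin 3) :
    HasDerivAt (fun s => F s a c) (F' t a c) t :=
  (hasDerivAt_pi.1 ((hasDerivAt_pi.1 h) a)) c

/-- **Differentiating `G J = 1` entrywise**: `Σ_b (G′ a b · J b c + G a b · J′ b c) = 0`. -/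
theorem deriv_mul_entry_eq_zero {G J G' J' : ℝ → Matrix (Fin 3) (Fin 3) ℝ} {t : ℝ} (hGJ : ∀ s, G s * J s = 1)
    (hG : HasDerivAt G (G' t) t) (hJ : HasDerivAt J (J' t) t) (a c : Fin 3) :
    ∑ b, (G' t a b * J t b c + G t a b * J' t b c) = 0 := by
  -- the entry `(G J) a c = Σ_b G a b J b c` is constant in `s`
  have hprod : HasDerivAt (fun s => ∑ b, G s a b * J s b c) (∑ b, (G' t a b * J t b c + G t a b * J' t b c)) t := by
    have h := HasDerivAt.fun_sum (u := Finset.univ) (A := fun b s => G s a b * J s b c)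
      (A' := fun b => G' t a b * J t b c + G t a b * J' t b c) (x := t)
      (fun b _ => by
        have h1 := (hasDerivAt_entry hG a b).mul (hasDerivAt_entry hJ b c)
        exact h1.congr_deriv (by ring))
    simpa using h
  have hconst : (fun s => ∑ b, G s a b * J s b c) = fun _ => (1 : Matrix (Fin 3) (Fin 3) ℝ) a c := by
    funext s
    have h := congrArg (fun M : Matrix (Fin 3) (Fin 3) ℝ => M a c) (hGJ s)
    simpa [Matrix.mul_apply] using h
  rw [hconst] at hprod
  exact hprod.unique (hasDerivAt_const t _)

/-- **The derivative of the inverse frame**: `J′ = −(J * G′ * J)` (from `G J = 1`, `J G = 1`). -/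
theorem inverse_deriv_eq {G J G' J' : ℝ → Matrix (Fin 3) (Fin 3) ℝ} {t : ℝ} (hGJ : ∀ s, G s * J s = 1)
    (hG : HasDerivAt G (G' t) t) (hJ : HasDerivAt J (J' t) t) : J' t = -(J t * G' t * J t) := by
  have hJG : J t * G t = 1 := mul_eq_one_comm.1 (hGJ t)
  -- `G′ J + G J′ = 0` as matrices
  have hsum : G' t * J t + G t * J' t = 0 := by
    ext a c
    have h := deriv_mul_entry_eq_zero hGJ hG hJ a c
    simpa [Matrix.mul_apply, Matrix.add_apply, Finset.sum_add_distrib] using h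
  -- multiply by `J` on the left
  have h2 : J t * (G' t * J t + G t * J' t) = 0 := by rw [hsum, Matrix.mul_zero]
  rw [Matrix.mul_add, ← Matrix.mul_assoc, ← Matrix.mul_assoc, hJG, Matrix.one_mul] at h2
  have h3 : J' t = -(J t * G' t * J t) := by
    have := eq_neg_of_add_eq_zero_right h2
    simpa using this
  exact h3

/-- **Explicit bound of the inverse-frame derivative**: `|J| ≤ C_J`, `|G′| ≤ B′` entrywise ⇒ `|J′ a c| ≤ 9·C_J·B′·C_J`. -/
theorem abs_inverse_deriv_entry_le {G J G' J' : ℝ → Matrix (Fin 3) (Fin 3) ℝ} {t : ℝ} (hGJ : ∀ s, G s * J s = 1)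
    (hG : HasDerivAt G (G' t) t) (hJ : HasDerivAt J (J' t) t) {CJ B' : ℝ} (hCJ0 : 0 ≤ CJ) (hB0 : 0 ≤ B')
    (hCJ : ∀ a c, |J t a c| ≤ CJ) (hB : ∀ a c, |G' t a c| ≤ B') (a c : Fin 3) : |J' t a c| ≤ 9 * (CJ * B' * CJ) := by
  rw [inverse_deriv_eq hGJ hG hJ, Matrix.neg_apply, abs_neg, Matrix.mul_apply]
  refine (Finset.abs_sum_le_sum_abs _ _).trans ?_
  have : ∀ d ∈ (Finset.univ : Finset (Fin 3)), |(J t * G' t) a d * J t d c| ≤ 3 * (CJ * B' * CJ) := fun d _ => by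
    rw [abs_mul, Matrix.mul_apply]
    have h1 : |∑ b, J t a b * G' t b d| ≤ 3 * (CJ * B') := by
      refine (Finset.abs_sum_le_sum_abs _ _).trans ?_
      have : ∀ b ∈ (Finset.univ : Finset (Fin 3)), |J t a b * G' t b d| ≤ CJ * B' := fun b _ => by
        rw [abs_mul]; exact mul_le_mul (hCJ a b) (hB b d) (abs_nonneg _) hCJ0
      refine (Finset.sum_le_sum this).trans ?_
      simp only [Finset.sum_const, Finset.card_univ, Fintype.card_fin, nsmul_eq_mul]; push_cast; linarith
    calc |∑ b, J t a b * G' t b d| * |J t d c| ≤ 3 * (CJ * B') * CJ := mul_le_mul h1 (hCJ d c) (abs_nonneg _) (by positivity)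
      _ = 3 * (CJ * B' * CJ) := by ring
  refine (Finset.sum_le_sum this).trans ?_
  simp only [Finset.sum_const, Finset.card_univ, Fintype.card_fin, nsmul_eq_mul]; push_cast; linarith

end Summit.AnomalousDissipation.AnomalousDissipation.Theorems.SolenoidalFractalHomogenisation.LagrangianStep.VmodDist

end
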